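/-
Copyright (c) 2026 the pub-hodgecm-mathlib formalisation cell (harness21).  Prover seat hodgecm-mathlib-K2E4-p10 (g11), Track B «K2-LIT»,
#184♮ = hLiu418 = `stmt-HodgeConjecture-24832`; socket #41, KIND 1 — (K1a-T)(L2-dock) (r)+(m2↑)+(m2↓) THE FRAME-vs-HEIGHT LETTERS (K1a desk K2Liu-p01 (g11)
WORD #18 (1), 2026-09-05T03:17:54Z): the entries of the tube frames of record `Fr(h_∞)_w = T_w·(h_∞)_w·T_w⁻¹` against the adelic height `‖h‖`, and the two-sided
comparison of the Siegel imaginary part `V(Fr(h_∞)_w) = Im(Fr(h_∞)_w·(i1))` with `‖h‖^{±2}` (ceiling twin and frame edition of ★ (m2) p864583).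
THEOREMS ONLY (no `def`, no `instance`, no notation, no named-fact hypothesis, no `sorry`).
-/
import Summits.HodgeConjecture.HodgeConjecture.Theorems.K2LiuArchSiegelHalfSpaceHeightBounds   -- ★ (m2) p864583 (K2E4-p10 (g10)) + ★ `K2LiuArchBlockHeightBound` (`norm_archAt_archPart_apply_le`, `norm_mul_apply_le`)
import Summits.HodgeConjecture.HodgeConjecture.Theorems.K2LiuSiegelUnipotentArchPlaces        -- ★ the doubled group `HA`, `hermD`, `e₂`, `archAt ∘ archPart` glue
import Mathlib.Algebra.Order.Chebyshev
import HarnessLib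

/-!
# Crux `HLiu418`, socket #41, KIND 1 a♮ — (K1a-T)(L2-dock)(r)(m2↑)(m2↓) `K2LiuKindOneSingularFrameHeightLetters`: TUBE FRAMES OF RECORD AGAINST THE ADELIC HEIGHT

Cell `hodgecm-mathlib`, crux item hLiu418 = `stmt-HodgeConjecture-24832` (helper lane `--supports … --as helper`, count-neutral), route of record `HCCMUnconditional`;
squad K2 ∕ K2Liu, road `K2_Liu`, socket #41, KIND 1, block K1-a♮.  CONSUMERS: (r) = ★ p864983 `K2LiuKindOneSingularPrefactorDictionary.hP_of_cornerReading`'s letter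
`hRw` (at `Rw X h w' := CR·‖gc X·h‖`, `aR := 1`) and (α) `K2LiuKindOneSingularArchLettersOfRecord`'s `hRw` (LH7-p05); (m2↑) = LH4-p17's `CornerTranslateReading` §6
`hpw_le_of_ceiling` ((v-β)'s (b↑)); (m2↓) = LH4-p17's §3 `hV_twisted_of_untwistedFloor` input `hV0` at `ρ h := ‖h‖^(−2)` ((vi)'s (c)).

THE MATHEMATICS ([BorelJacquet1979, §1.2 (i), §4.1]; [Shimura1997, §6.3]; [MoeglinWaldspurger1995, I.2.2]).  The frames of record are `Fr a w = T_w · (a_w) · T_w⁻¹`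
(`(a_w)` = the `w`-component `archAt w a` re-indexed on `Fin 2 ⊕ Fin 2`; `T_w, T_w⁻¹` the closed-form Shimura frames of ★ `exists_tubeFrame_arch₄` (x) — here BY VALUE: any
family of matrices on the finitely many complex places has a uniform entry bound `RT ≥ 1`).  Every archimedean entry of `h ∈ H(𝔸)` is `≤ ‖h‖` (★ `norm_archAt_archPart_apply_le`),
so `|Fr(h_∞)_w i j| ≤ 16·RT²·‖h‖` (§2 `entry_frame_le_height`, the constant `CR ≥ 1`).  For a `J`-unitary `P` with entries `≤ R` the imaginary part `V(P) = (Mᴴ)⁻¹M⁻¹`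
(`M = denom(P, i1)`) has entries `≤ m(2mR)²` (★ (m2) `norm_im_moeb_I_apply_le`) and `λ_min ≥ (2mR)⁻²` (★ (m2) `re_star_dotProduct_im_moeb_I_mulVec_ge`); with the
Cauchy–Schwarz step `Re⟨v, Xv⟩ ≤ m·a·Σ‖v_i‖²` (§1 `re_star_dotProduct_mulVec_le`) this gives the CEILING twin §1 `re_star_dotProduct_im_moeb_I_mulVec_le`, and at the frames
(`R := CR·‖h‖`, `hFrU`: the frames are `J`-unitary) the two-sided letters §2 `im_moeb_frame_ceiling` (`≤ CV·‖h‖²·Σ‖v_k‖²`) and `im_moeb_frame_floor` (`cV·‖h‖^(−2)·Σ‖v_k‖² ≤`),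
with their `∀ w' ∈ Tinf` docks `…_on` in the binder shape of LH4-p17's `hV0`.
HONEST LABEL.  Count-neutral helper (matrix-entry bookkeeping over ★ letters); it closes no socket: `HC_CM` is proved only modulo the 7 printed citations (2 remaining named
inputs: hLiu418 = `stmt-HodgeConjecture-24832`, h413 = `stmt-HodgeConjecture-24833`) until rung 0 closes.

## References
* [BorelJacquet1979] A. Borel, H. Jacquet, *Automorphic forms and automorphic representations*, PSPM 33.1 (1979): §1.2 (property (i)), §4.1.
* [Shimura1997] G. Shimura, *Euler Products and Eisenstein Series*, CBMS 93 (1997): §6.3, §18.4.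
* [MoeglinWaldspurger1995] C. Mœglin, J.-L. Waldspurger, *Spectral Decomposition and Eisenstein Series* (1995): I.2.2.
-/

set_option autoImplicit false
-- the mandated namespace repeats the single-problem summit's segment (`HodgeConjecture.HodgeConjecture`)
set_option linter.dupNamespace false

noncomputable section

open scoped Matrix ComplexOrder
open Complex Matrix Finset NumberField NumberField.InfinitePlace IsDedekindDomain
open Literature.NumberTheory.ModularForms.SiegelUpperHalfSpace (moeb)
open Literature.NumberTheory.Automorphic Literature.NumberTheory.Automorphic.UnitaryGroup
open Literature.NumberTheory.GelbartRogawski1991 Literature.NumberTheory.GelbartRogawski1991.GRConstruction Literature.NumberTheory.GelbartRogawski1991.AdaptedBlocks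
open Literature.NumberTheory.GelbartRogawski1991.UnitaryDualPair

namespace Summit.HodgeConjecture.HodgeConjecture.Cruxes.HLiu418.K2LiuKindOneSingularFrameHeightLetters

open K2LiuArchBlockHeightBound (norm_mul_apply_le norm_archAt_archPart_apply_le)
open K2LiuArchSiegelHalfSpaceHeightBounds (norm_star_dotProduct_le norm_mulVec_apply_le norm_im_moeb_I_apply_le re_star_dotProduct_im_moeb_I_mulVec_ge)

/-! ## §1 The quadratic-form ceiling (generic index type) -/

section Ceiling

variable {l : Type*} [Fintype l] [DecidableEq l]

omit [DecidableEq l] in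
/-- **Cauchy–Schwarz ceiling of a quadratic form by its entries**: `Re⟨v, Xv⟩ ≤ (m·a)·Σ_i ‖v_i‖²` when the entries of `X` are `≤ a` (`a ≥ 0`, `m = |l|`;
`|⟨v,Xv⟩| ≤ a·‖v‖₁²`, `‖v‖₁² ≤ m·‖v‖₂²`). [folklore] -/
theorem re_star_dotProduct_mulVec_le {X : Matrix l l ℂ} {a : ℝ} (ha : 0 ≤ a) (hX : ∀ i j, ‖X i j‖ ≤ a) (v : l → ℂ) :
    (star v ⬝ᵥ (X *ᵥ v)).re ≤ (Fintype.card l * a) * ∑ i, ‖v i‖ ^ 2 := by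
  have hcs : (∑ i, ‖v i‖) ^ 2 ≤ Fintype.card l * ∑ i, ‖v i‖ ^ 2 := by
    have h := sq_sum_le_card_mul_sum_sq (s := (Finset.univ : Finset l)) (f := fun i => ‖v i‖)
    rwa [Finset.card_univ] at h
  calc (star v ⬝ᵥ (X *ᵥ v)).re ≤ ‖star v ⬝ᵥ (X *ᵥ v)‖ := Complex.re_le_norm _
    _ ≤ ∑ j, ‖v j‖ * ‖(X *ᵥ v) j‖ := norm_star_dotProduct_le v _
    _ ≤ ∑ j, ‖v j‖ * (a * ∑ k, ‖v k‖) := Finset.sum_le_sum fun j _ => mul_le_mul_of_nonneg_left (norm_mulVec_apply_le hX v j) (norm_nonneg _)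
    _ = a * (∑ i, ‖v i‖) ^ 2 := by rw [← Finset.sum_mul, sq]; ring
    _ ≤ a * (Fintype.card l * ∑ i, ‖v i‖ ^ 2) := mul_le_mul_of_nonneg_left hcs ha
    _ = (Fintype.card l * a) * ∑ i, ‖v i‖ ^ 2 := by ring

/-- **THE CEILING TWIN OF ★ (m2) `re_star_dotProduct_im_moeb_I_mulVec_ge`**: for `P ∈ U(J)` with entries `≤ R`, the Siegel imaginary part `V = Im(P·(i1))` satisfies
`Re(vᴴ·V·v) ≤ m·(m(2mR)²)·Σ_i ‖v_i‖²` (entries of `V` are `≤ m(2mR)²`, ★ (m2) `norm_im_moeb_I_apply_le`). [cite: Shimura1997, §6.3] [cite: BorelJacquet1979, §1.2] -/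
theorem re_star_dotProduct_im_moeb_I_mulVec_le {P : Matrix (l ⊕ l) (l ⊕ l) ℂ} (hP : Pᴴ * Matrix.J l ℂ * P = Matrix.J l ℂ) {R : ℝ}
    (hR : ∀ i j, ‖P i j‖ ≤ R) (v : l → ℂ) :
    (star v ⬝ᵥ (((2 * I)⁻¹ • (moeb P (I • (1 : Matrix l l ℂ)) - (moeb P (I • (1 : Matrix l l ℂ)))ᴴ)) *ᵥ v)).re ≤
      (Fintype.card l * (Fintype.card l * (2 * Fintype.card l * R) ^ 2)) * ∑ i, ‖v i‖ ^ 2 :=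
  re_star_dotProduct_mulVec_le (by positivity) (norm_im_moeb_I_apply_le hP hR) v

end Ceiling

/-! ## §2 The tube frames of record against the adelic height -/

/-- any two families of matrices over finite index types have a common entry bound `RT ≥ 1` (the frames `T_w, T_w⁻¹` of record: finitely many complex places). [folklore] -/
theorem exists_entry_bound {ι m : Type*} [Finite ι] [Finite m] (T Tinv : ι → Matrix m m ℂ) :
    ∃ RT : ℝ, 1 ≤ RT ∧ ∀ w i j, ‖T w i j‖ ≤ RT ∧ ‖Tinv w i j‖ ≤ RT := by
  obtain ⟨B, hB⟩ := Finite.exists_le (fun p : ι × m × m => max ‖T p.1 p.2.1 p.2.2‖ ‖Tinv p.1 p.2.1 p.2.2‖)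
  exact ⟨max B 1, le_max_right _ _, fun w i j =>
    ⟨((le_max_left _ _).trans (hB (w, i, j))).trans (le_max_left _ _), ((le_max_right _ _).trans (hB (w, i, j))).trans (le_max_left _ _)⟩⟩

section Frames

variable (L : Type) [Field L] [NumberField L] [IsCMField L]
variable {N M : ℕ} (e : Fin N × Fin M ≃ Fin 2) (dV : Fin N → L) (hdV : ∀ i, IsCMField.complexConj L (dV i) = dV i)
  (dW : Fin M → L) (hdW : ∀ i, IsCMField.complexConj L (dW i) = dW i)

/-- **(r) THE FRAME ENTRIES AGAINST THE HEIGHT.**  For the frames of record `Fr a w = T_w · (a_w) · T_w⁻¹` (`hFr` = ★ `K2LiuKindWArchContinuationFramesOfRecord`'s bytes, `T Tinv`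
BY VALUE): `∃ CR ≥ 1, ∀ h w i j, ‖Fr(h_∞) w i j‖ ≤ CR·‖h‖` (`CR = 16·RT²`; every entry of `(h_∞)_w` is `≤ ‖h‖` by ★ `norm_archAt_archPart_apply_le`).
[cite: BorelJacquet1979, §1.2 (property (i)), §4.1] [cite: MoeglinWaldspurger1995, I.2.2] -/
theorem entry_frame_le_height (T Tinv : {w : InfinitePlace L // w.IsComplex} → Matrix (Fin 2 ⊕ Fin 2) (Fin 2 ⊕ Fin 2) ℂ)
    (Fr : UnitaryGroup.arch (Fp L) L (IsCMField.complexConj L) (2 + 2) (hermD L e dV hdV dW hdW) → {w : InfinitePlace L // w.IsComplex} →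
      Matrix (Fin 2 ⊕ Fin 2) (Fin 2 ⊕ Fin 2) ℂ)
    (hFr : ∀ a w, Fr a w = T w * Matrix.reindex (e₂ (n := 2)).symm (e₂ (n := 2)).symm
        (((UnitaryGroup.archAt (Fp L) L (IsCMField.complexConj L) (2 + 2) (hermD L e dV hdV dW hdW) w
          (UnitaryGroup.complexConj_smul_infinitePlace L w.1) (IsCMField.complexConj_ne_one L) a :
            UnitaryGroup.archLocal L (2 + 2) (hermD L e dV hdV dW hdW) w) : GL (Fin (2 + 2)) ℂ) : Matrix (Fin (2 + 2)) (Fin (2 + 2)) ℂ) * Tinv w) :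
    ∃ CR : ℝ, 1 ≤ CR ∧ ∀ (h : HA L e dV hdV dW hdW) (w : {w : InfinitePlace L // w.IsComplex}) (i j : Fin 2 ⊕ Fin 2),
      ‖Fr (UnitaryGroup.archPart (Fp L) L (IsCMField.complexConj L) (2 + 2) (hermD L e dV hdV dW hdW) h) w i j‖ ≤
        CR * adelicHeightGL (2 + 2) L (h : GL (Fin (2 + 2)) (AdeleRing (𝓞 L) L)) := by
  obtain ⟨RT, hRT1, hRT⟩ := exists_entry_bound T Tinv
  haveI : NeZero (2 + 2) := ⟨by norm_num⟩
  have hRT0 : 0 ≤ RT := zero_le_one.trans hRT1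
  refine ⟨(Fintype.card (Fin 2 ⊕ Fin 2) : ℝ) * ((Fintype.card (Fin 2 ⊕ Fin 2) : ℝ) * RT * RT), ?_, fun h w i j => ?_⟩
  · simp only [Fintype.card_sum, Fintype.card_fin]
    push_cast
    nlinarith
  · set H : ℝ := adelicHeightGL (2 + 2) L (h : GL (Fin (2 + 2)) (AdeleRing (𝓞 L) L)) with hHdef
    have hH0 : 0 ≤ H := adelicHeightGL_nonneg _
    have hM : ∀ i j, ‖(Matrix.reindex (e₂ (n := 2)).symm (e₂ (n := 2)).symm
        (((UnitaryGroup.archAt (Fp L) L (IsCMField.complexConj L) (2 + 2) (hermD L e dV hdV dW hdW) w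
          (UnitaryGroup.complexConj_smul_infinitePlace L w.1) (IsCMField.complexConj_ne_one L)
          (UnitaryGroup.archPart (Fp L) L (IsCMField.complexConj L) (2 + 2) (hermD L e dV hdV dW hdW) h) :
            UnitaryGroup.archLocal L (2 + 2) (hermD L e dV hdV dW hdW) w) : GL (Fin (2 + 2)) ℂ) : Matrix (Fin (2 + 2)) (Fin (2 + 2)) ℂ)) i j‖ ≤ H := by
      intro i j
      rw [Matrix.reindex_apply, Matrix.submatrix_apply]
      exact (norm_archAt_archPart_apply_le (Fp L) L (IsCMField.complexConj L) (2 + 2) (hermD L e dV hdV dW hdW) w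
        (UnitaryGroup.complexConj_smul_infinitePlace L w.1) (IsCMField.complexConj_ne_one L) h _ _).1
    have h1 := norm_mul_apply_le hRT0 (fun i j => (hRT w i j).1) hM
    have h2 := norm_mul_apply_le (by positivity) h1 (fun i j => (hRT w i j).2) i j
    rw [hFr]
    calc _ ≤ (Fintype.card (Fin 2 ⊕ Fin 2) : ℝ) * ((Fintype.card (Fin 2 ⊕ Fin 2) : ℝ) * (RT * H) * RT) := h2
      _ = (Fintype.card (Fin 2 ⊕ Fin 2) : ℝ) * ((Fintype.card (Fin 2 ⊕ Fin 2) : ℝ) * RT * RT) * H := by ring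

/-- **(m2↑) THE CEILING AT THE FRAMES**: for the `J`-unitary frames of record (`hFrU`, LH4-p17's by-value letter) `∃ CV ≥ 0, ∀ h w v,
Re⟨v, V(Fr(h_∞)_w)·v⟩ ≤ CV·‖h‖²·Σ_k ‖v_k‖²` (§1 at `R := CR·‖h‖`). [cite: Shimura1997, §6.3] [cite: BorelJacquet1979, §1.2, §4.1] -/
theorem im_moeb_frame_ceiling (T Tinv : {w : InfinitePlace L // w.IsComplex} → Matrix (Fin 2 ⊕ Fin 2) (Fin 2 ⊕ Fin 2) ℂ)
    (Fr : UnitaryGroup.arch (Fp L) L (IsCMField.complexConj L) (2 + 2) (hermD L e dV hdV dW hdW) → {w : InfinitePlace L // w.IsComplex} →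
      Matrix (Fin 2 ⊕ Fin 2) (Fin 2 ⊕ Fin 2) ℂ)
    (hFr : ∀ a w, Fr a w = T w * Matrix.reindex (e₂ (n := 2)).symm (e₂ (n := 2)).symm
        (((UnitaryGroup.archAt (Fp L) L (IsCMField.complexConj L) (2 + 2) (hermD L e dV hdV dW hdW) w
          (UnitaryGroup.complexConj_smul_infinitePlace L w.1) (IsCMField.complexConj_ne_one L) a :
            UnitaryGroup.archLocal L (2 + 2) (hermD L e dV hdV dW hdW) w) : GL (Fin (2 + 2)) ℂ) : Matrix (Fin (2 + 2)) (Fin (2 + 2)) ℂ) * Tinv w)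
    (hFrU : ∀ (a : UnitaryGroup.arch (Fp L) L (IsCMField.complexConj L) (2 + 2) (hermD L e dV hdV dW hdW)) (w : {w : InfinitePlace L // w.IsComplex}),
      (Fr a w)ᴴ * Matrix.J (Fin 2) ℂ * Fr a w = Matrix.J (Fin 2) ℂ) :
    ∃ CV : ℝ, 0 ≤ CV ∧ ∀ (h : HA L e dV hdV dW hdW) (w : {w : InfinitePlace L // w.IsComplex}) (v : Fin 2 → ℂ),
      (star v ⬝ᵥ (((2 * I)⁻¹ • (moeb (Fr (UnitaryGroup.archPart (Fp L) L (IsCMField.complexConj L) (2 + 2) (hermD L e dV hdV dW hdW) h) w) (I • (1 : Matrix (Fin 2) (Fin 2) ℂ)) -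
          (moeb (Fr (UnitaryGroup.archPart (Fp L) L (IsCMField.complexConj L) (2 + 2) (hermD L e dV hdV dW hdW) h) w) (I • (1 : Matrix (Fin 2) (Fin 2) ℂ)))ᴴ)) *ᵥ v)).re ≤
        CV * adelicHeightGL (2 + 2) L (h : GL (Fin (2 + 2)) (AdeleRing (𝓞 L) L)) ^ 2 * ∑ k, ‖v k‖ ^ 2 := by
  obtain ⟨CR, hCR1, hCR⟩ := entry_frame_le_height L e dV hdV dW hdW T Tinv Fr hFr
  refine ⟨2 * (2 * (2 * 2 * CR) ^ 2), by positivity, fun h w v => ?_⟩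
  have hb := re_star_dotProduct_im_moeb_I_mulVec_le (hFrU _ w) (fun i j => hCR h w i j) v
  rw [Fintype.card_fin] at hb
  refine hb.trans (le_of_eq ?_)
  push_cast
  ring

/-- **(m2↓) THE FLOOR AT THE FRAMES** (★ (m2) `re_star_dotProduct_im_moeb_I_mulVec_ge` at `R := CR·‖h‖`): `∃ cV > 0, ∀ h w v, cV·‖h‖^(−2)·Σ_k ‖v_k‖² ≤ Re⟨v, V(Fr(h_∞)_w)·v⟩`
(`cV = (4·CR)⁻²`; the rpow `‖h‖ ^ (-(2 : ℝ))` is LH4-p17's `ρ h := ‖h‖^(−aV)` at `aV := 2`). [cite: Shimura1997, §6.3] [cite: BorelJacquet1979, §1.2, §4.1] -/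
theorem im_moeb_frame_floor (T Tinv : {w : InfinitePlace L // w.IsComplex} → Matrix (Fin 2 ⊕ Fin 2) (Fin 2 ⊕ Fin 2) ℂ)
    (Fr : UnitaryGroup.arch (Fp L) L (IsCMField.complexConj L) (2 + 2) (hermD L e dV hdV dW hdW) → {w : InfinitePlace L // w.IsComplex} →
      Matrix (Fin 2 ⊕ Fin 2) (Fin 2 ⊕ Fin 2) ℂ)
    (hFr : ∀ a w, Fr a w = T w * Matrix.reindex (e₂ (n := 2)).symm (e₂ (n := 2)).symm
        (((UnitaryGroup.archAt (Fp L) L (IsCMField.complexConj L) (2 + 2) (hermD L e dV hdV dW hdW) w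
          (UnitaryGroup.complexConj_smul_infinitePlace L w.1) (IsCMField.complexConj_ne_one L) a :
            UnitaryGroup.archLocal L (2 + 2) (hermD L e dV hdV dW hdW) w) : GL (Fin (2 + 2)) ℂ) : Matrix (Fin (2 + 2)) (Fin (2 + 2)) ℂ) * Tinv w)
    (hFrU : ∀ (a : UnitaryGroup.arch (Fp L) L (IsCMField.complexConj L) (2 + 2) (hermD L e dV hdV dW hdW)) (w : {w : InfinitePlace L // w.IsComplex}),
      (Fr a w)ᴴ * Matrix.J (Fin 2) ℂ * Fr a w = Matrix.J (Fin 2) ℂ) :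
    ∃ cV : ℝ, 0 < cV ∧ ∀ (h : HA L e dV hdV dW hdW) (w : {w : InfinitePlace L // w.IsComplex}) (v : Fin 2 → ℂ),
      cV * adelicHeightGL (2 + 2) L (h : GL (Fin (2 + 2)) (AdeleRing (𝓞 L) L)) ^ (-(2 : ℝ)) * ∑ k, ‖v k‖ ^ 2 ≤
        (star v ⬝ᵥ (((2 * I)⁻¹ • (moeb (Fr (UnitaryGroup.archPart (Fp L) L (IsCMField.complexConj L) (2 + 2) (hermD L e dV hdV dW hdW) h) w) (I • (1 : Matrix (Fin 2) (Fin 2) ℂ)) -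
          (moeb (Fr (UnitaryGroup.archPart (Fp L) L (IsCMField.complexConj L) (2 + 2) (hermD L e dV hdV dW hdW) h) w) (I • (1 : Matrix (Fin 2) (Fin 2) ℂ)))ᴴ)) *ᵥ v)).re := by
  obtain ⟨CR, hCR1, hCR⟩ := entry_frame_le_height L e dV hdV dW hdW T Tinv Fr hFr
  refine ⟨((2 * (2 * CR)) ^ 2)⁻¹, by positivity, fun h w v => ?_⟩
  have hH0 : 0 ≤ adelicHeightGL (2 + 2) L (h : GL (Fin (2 + 2)) (AdeleRing (𝓞 L) L)) := adelicHeightGL_nonneg _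
  have hb := re_star_dotProduct_im_moeb_I_mulVec_ge (hFrU _ w) (fun i j => hCR h w i j) v
  rw [Fintype.card_fin] at hb
  refine le_trans (le_of_eq ?_) hb
  rw [Real.rpow_neg hH0, Real.rpow_two]
  push_cast
  ring

/-- **(m2↑) on a place set**, in the binder shape of LH4-p17's `hV0` (`∀ h, ∀ w' ∈ Tinf, ∀ v`, the complex place `⟨w', IsTotallyComplex.isComplex w'⟩`). [cite: Shimura1997, §6.3] -/
theorem im_moeb_frame_ceiling_on (Tinf : Finset (InfinitePlace L)) (T Tinv : {w : InfinitePlace L // w.IsComplex} → Matrix (Fin 2 ⊕ Fin 2) (Fin 2 ⊕ Fin 2) ℂ)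
    (Fr : UnitaryGroup.arch (Fp L) L (IsCMField.complexConj L) (2 + 2) (hermD L e dV hdV dW hdW) → {w : InfinitePlace L // w.IsComplex} →
      Matrix (Fin 2 ⊕ Fin 2) (Fin 2 ⊕ Fin 2) ℂ)
    (hFr : ∀ a w, Fr a w = T w * Matrix.reindex (e₂ (n := 2)).symm (e₂ (n := 2)).symm
        (((UnitaryGroup.archAt (Fp L) L (IsCMField.complexConj L) (2 + 2) (hermD L e dV hdV dW hdW) w
          (UnitaryGroup.complexConj_smul_infinitePlace L w.1) (IsCMField.complexConj_ne_one L) a :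
            UnitaryGroup.archLocal L (2 + 2) (hermD L e dV hdV dW hdW) w) : GL (Fin (2 + 2)) ℂ) : Matrix (Fin (2 + 2)) (Fin (2 + 2)) ℂ) * Tinv w)
    (hFrU : ∀ (a : UnitaryGroup.arch (Fp L) L (IsCMField.complexConj L) (2 + 2) (hermD L e dV hdV dW hdW)) (w : {w : InfinitePlace L // w.IsComplex}),
      (Fr a w)ᴴ * Matrix.J (Fin 2) ℂ * Fr a w = Matrix.J (Fin 2) ℂ) :
    ∃ CV : ℝ, 0 ≤ CV ∧ ∀ (h : HA L e dV hdV dW hdW), ∀ w' ∈ Tinf, ∀ v : Fin 2 → ℂ,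
      (star v ⬝ᵥ (((2 * I)⁻¹ • (moeb (Fr (UnitaryGroup.archPart (Fp L) L (IsCMField.complexConj L) (2 + 2) (hermD L e dV hdV dW hdW) h) ⟨w', IsTotallyComplex.isComplex w'⟩)
            (I • (1 : Matrix (Fin 2) (Fin 2) ℂ)) -
          (moeb (Fr (UnitaryGroup.archPart (Fp L) L (IsCMField.complexConj L) (2 + 2) (hermD L e dV hdV dW hdW) h) ⟨w', IsTotallyComplex.isComplex w'⟩)
            (I • (1 : Matrix (Fin 2) (Fin 2) ℂ)))ᴴ)) *ᵥ v)).re ≤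
        CV * adelicHeightGL (2 + 2) L (h : GL (Fin (2 + 2)) (AdeleRing (𝓞 L) L)) ^ 2 * ∑ k, ‖v k‖ ^ 2 := by
  obtain ⟨CV, hCV, h⟩ := im_moeb_frame_ceiling L e dV hdV dW hdW T Tinv Fr hFr hFrU
  exact ⟨CV, hCV, fun h' w' _ v => h h' ⟨w', IsTotallyComplex.isComplex w'⟩ v⟩

/-- **(m2↓) on a place set**, in the binder shape of LH4-p17's `hV0` with `ρ h := ‖h‖ ^ (-(2 : ℝ))` (`∀ h, ∀ w' ∈ Tinf, ∀ v`). [cite: Shimura1997, §6.3] -/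
theorem im_moeb_frame_floor_on (Tinf : Finset (InfinitePlace L)) (T Tinv : {w : InfinitePlace L // w.IsComplex} → Matrix (Fin 2 ⊕ Fin 2) (Fin 2 ⊕ Fin 2) ℂ)
    (Fr : UnitaryGroup.arch (Fp L) L (IsCMField.complexConj L) (2 + 2) (hermD L e dV hdV dW hdW) → {w : InfinitePlace L // w.IsComplex} →
      Matrix (Fin 2 ⊕ Fin 2) (Fin 2 ⊕ Fin 2) ℂ)
    (hFr : ∀ a w, Fr a w = T w * Matrix.reindex (e₂ (n := 2)).symm (e₂ (n := 2)).symm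
        (((UnitaryGroup.archAt (Fp L) L (IsCMField.complexConj L) (2 + 2) (hermD L e dV hdV dW hdW) w
          (UnitaryGroup.complexConj_smul_infinitePlace L w.1) (IsCMField.complexConj_ne_one L) a :
            UnitaryGroup.archLocal L (2 + 2) (hermD L e dV hdV dW hdW) w) : GL (Fin (2 + 2)) ℂ) : Matrix (Fin (2 + 2)) (Fin (2 + 2)) ℂ) * Tinv w)
    (hFrU : ∀ (a : UnitaryGroup.arch (Fp L) L (IsCMField.complexConj L) (2 + 2) (hermD L e dV hdV dW hdW)) (w : {w : InfinitePlace L // w.IsComplex}),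
      (Fr a w)ᴴ * Matrix.J (Fin 2) ℂ * Fr a w = Matrix.J (Fin 2) ℂ) :
    ∃ cV : ℝ, 0 < cV ∧ ∀ (h : HA L e dV hdV dW hdW), ∀ w' ∈ Tinf, ∀ v : Fin 2 → ℂ,
      cV * adelicHeightGL (2 + 2) L (h : GL (Fin (2 + 2)) (AdeleRing (𝓞 L) L)) ^ (-(2 : ℝ)) * ∑ k, ‖v k‖ ^ 2 ≤
        (star v ⬝ᵥ (((2 * I)⁻¹ • (moeb (Fr (UnitaryGroup.archPart (Fp L) L (IsCMField.complexConj L) (2 + 2) (hermD L e dV hdV dW hdW) h) ⟨w', IsTotallyComplex.isComplex w'⟩)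
            (I • (1 : Matrix (Fin 2) (Fin 2) ℂ)) -
          (moeb (Fr (UnitaryGroup.archPart (Fp L) L (IsCMField.complexConj L) (2 + 2) (hermD L e dV hdV dW hdW) h) ⟨w', IsTotallyComplex.isComplex w'⟩)
            (I • (1 : Matrix (Fin 2) (Fin 2) ℂ)))ᴴ)) *ᵥ v)).re := by
  obtain ⟨cV, hcV, h⟩ := im_moeb_frame_floor L e dV hdV dW hdW T Tinv Fr hFr hFrU
  exact ⟨cV, hcV, fun h' w' _ v => h h' ⟨w', IsTotallyComplex.isComplex w'⟩ v⟩

end Frames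

end Summit.HodgeConjecture.HodgeConjecture.Cruxes.HLiu418.K2LiuKindOneSingularFrameHeightLetters

end
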